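import Summits.AtomisticToContinuum.Crystallization.Theorems.FreeSplittingCertificatesStrictSplittingRuleCoreDefs

/-!
# `StrictSplittingRule` (stmt-AtomisticToContinuum-12560), line `registered` (birth): combined sitewise coercivity H2⋆ and assembly H3⋆ (reshape r4)

Route `FreeSplittingCertificates`, crux r3 `StrictSplittingRule`, line `registered`.  Third piece of reshape r4 (lead c4,
2026-08-17), split off `…CoreDefs.lean` for the 400-line limit.  `…CoreDefs.lean` carries r3's `CoreFirstOrderDesign`
(H1, landed p158539), `CoreSitewiseHarmonic` (H2, radial, ∃κ), `CoreAssembly` (H3, misstated) and r4's single-norm forms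
`CoreSitewiseCoercive`/`CoreShellCoercive` (+ assemblies, anchors; p161758, p162107).  This file states the COMBINED
form with two explicit constants, which is what the perturbative assembly needs and what the r4 skeleton registers:

* `CoreStarCoercive a h κ₁ κ₃` (H2⋆, stub `stub_coreStarCoercive`): one covariant decaying transfer family makes every
  site's half-split second variation `≥ κ₁·Σ_shell stretch² + κ₃·dist²(recentred shell displacement, rotations)`;
* `CoreStarAssembly κ₁ κ₃ N₀ a h` (H3⋆, stub `stub_coreStarAssembly`): H1 ∧ H2⋆ ⇒ `PerturbativeCore` at `η₀ ≤ a/N₀`;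
* bridges `coreShellCoercive_of_star`, `coreSitewiseHarmonic_of_star` (r3's H2 is a corollary), `coreStarCoercive_mono`,
  `coreStarAssembly_of_shell`, and the registered anchor `stub_perturbativeCoreOfStarPieces` (composition, proved).

Line-internal proof obligations (each asserted by its own registered stub), not facts; nothing landed assumes them.
All [folklore] bookkeeping.  Evidence: item files ASSEMBLY-ARCHITECTURE.md, SOS-NUMERICS.md (cycle 4).
-/

noncomputable section

namespace Summit.AtomisticToContinuum.Crystallization.Theorems.StrictSplittingRuleBirth

open scoped BigOperators Classical
open Literature.MathematicalPhysics.StatisticalMechanics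
open Literature.Geometry.DiscreteGeometry
open Summit.AtomisticToContinuum.Crystallization.Theorems.PalmUnimodularRigidity.LayeredLawsSelectHcp
  (hcpSite ljSqDeriv)

/-- Euclidean `3`-space. -/
local notation "E3" => EuclideanSpace ℝ (Fin 3)

/-! ## The combined ("star") form

The global coercivity constants of relaxed LJ-hcp are strongly anisotropic in mode space: by Bloch waves (cycle-4 numerics,
compute/local_bloch_L3r.py, a* = 0.97132, h* = 0.79296) `κ_glob = 1.932` for the radial-stretch norm
`Σ_shell ⟨d_q, u_q−u_p⟩²` but only `0.263` for the recentred rotation norm `Σ_shell ‖u_q−u_p−W d_q‖²` (both attained in the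
long-wave in-plane shear limit; `0.433` for the full rigid distance of the 13-cluster, `0.386` for the 60 NN-bond stretches of
the 19-cluster).  The cubic remainder of the half-split pair energies at shell residual amplitude `ρ` is
`≤ (18.8ρ + 106ρ²)·Σ x_q² + (1.41ρ + 0.73ρ²)·Σ y_q²` (`x` longitudinal, `y` transverse; `W′(a*²) = −0.1206, W″ = 2.902,
W‴ = −33.12, W⁗ = 361.1`): its large part is a STRETCH quantity, which the stiff radial coercivity absorbs, while strictness
and the small transverse remainder need the soft rotation norm.  A single-norm H2 therefore either cannot give strictness
(radial only, r3) or cannot reach `η₀ = a/100` (rotation only: `κ ≤ 0.263 < 1.3·(18.8ρ+106ρ²) = 0.258…` leaves no margin).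
The combined statement below carries both constants; the sitewise ledger is AFFINE in the transfers, so it is equivalent
to having one transfer family for each bound (average them), and it implies r3's `CoreSitewiseHarmonic` (κ₁ > 0) and
`CoreShellCoercive` (κ₁ ≥ 0).
-/

/-- **H2⋆ — COMBINED sitewise coercivity with explicit constants `κ₁` (radial stretches) and `κ₃` (recentred rotations)**:
one Bravais-covariant `(1+r)⁻⁶`-decaying antisymmetric transfer family makes every site's half-split second variation
`≥ κ₁·Σ_shell ⟨y_q−y_p, u_q−u_p⟩² + κ₃·Σ_shell ‖u_q−u_p−W(y_q−y_p)‖²` for some skew `W`.  The registered form of H2 after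
reshape r4 (stub `stub_coreStarCoercive`); truth = a sitewise-SOS semidefinite feasibility problem, necessarily with
`κ₁/1.932 + κ₃/0.263 ≤ 1`. [folklore] -/
def CoreStarCoercive (a h κ₁ κ₃ : ℝ) : Prop :=
  ∃ (C : ℝ) (Y : Finset (ℤ × ℤ × ℤ))
    (M N : Bool → (ℤ × ℤ × ℤ) → (ℤ × ℤ × ℤ) → (ℤ × ℤ × ℤ) → ℝ),
    (∀ b d s s', s ∉ Y ∨ s' ∉ Y → M b d s s' = 0 ∧ N b d s s' = 0) ∧
    (∀ p q : ℤ × ℤ × ℤ, ∀ s s', |M (decide (Even p.1)) (q - p) s s'| ≤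
        C * ((1 + ‖hcpSite a h q - hcpSite a h p‖)⁻¹) ^ 6 ∧
      |N (decide (Even p.1)) (q - p) s s'| ≤ C * ((1 + ‖hcpSite a h q - hcpSite a h p‖)⁻¹) ^ 6) ∧
    ∀ u : ℤ × ℤ × ℤ → E3, (Function.support u).Finite → ∀ p : ℤ × ℤ × ℤ,
      ∃ W : E3 →ₗ[ℝ] E3, (∀ z : E3, inner ℝ (W z) z = 0) ∧
      κ₁ * (∑' q : ℤ × ℤ × ℤ,
          (if 0 < ‖hcpSite a h q - hcpSite a h p‖ ∧ ‖hcpSite a h q - hcpSite a h p‖ ≤ 11 / 10 * a then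
            (inner ℝ (hcpSite a h q - hcpSite a h p) (u q - u p)) ^ 2 else (0 : ℝ))) +
      κ₃ * (∑' q : ℤ × ℤ × ℤ,
          (if 0 < ‖hcpSite a h q - hcpSite a h p‖ ∧ ‖hcpSite a h q - hcpSite a h p‖ ≤ 11 / 10 * a then
            ‖u q - u p - W (hcpSite a h q - hcpSite a h p)‖ ^ 2 else (0 : ℝ))) ≤
      (∑' q : ℤ × ℤ × ℤ, (if q = p then (0 : ℝ) else
          1 / 2 * (ljSqDeriv (‖hcpSite a h q - hcpSite a h p‖ ^ 2) * ‖u q - u p‖ ^ 2 +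
            2 * (1 / 2 * (7 * ((‖hcpSite a h q - hcpSite a h p‖ ^ 2)⁻¹) ^ 8 -
              4 * ((‖hcpSite a h q - hcpSite a h p‖ ^ 2)⁻¹) ^ 5)) *
              (inner ℝ (hcpSite a h q - hcpSite a h p) (u q - u p)) ^ 2))) +
      (∑' q : ℤ × ℤ × ℤ, (if q = p then (0 : ℝ) else
          ∑ s ∈ Y, ∑ s' ∈ Y,
            (M (decide (Even p.1)) (q - p) s s' *
                (inner ℝ (hcpSite a h (p + s) - hcpSite a h p) (u (p + s) - u p) *
                  inner ℝ (hcpSite a h (p + s') - hcpSite a h p) (u (p + s') - u p)) -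
              M (decide (Even q.1)) (p - q) s s' *
                (inner ℝ (hcpSite a h (q + s) - hcpSite a h q) (u (q + s) - u q) *
                  inner ℝ (hcpSite a h (q + s') - hcpSite a h q) (u (q + s') - u q)) +
              (N (decide (Even p.1)) (q - p) s s' - N (decide (Even q.1)) (p - q) s' s) *
                (inner ℝ (hcpSite a h (p + s) - hcpSite a h p) (u (p + s) - u p) *
                  inner ℝ (hcpSite a h (q + s') - hcpSite a h q) (u (q + s') - u q)))))

/-- The combined form with `κ₁ ≥ 0` implies the recentred rotation form with constant `κ₃`. -/
theorem coreShellCoercive_of_star {a h κ₁ κ₃ : ℝ} (h₁ : 0 ≤ κ₁) :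
    CoreStarCoercive a h κ₁ κ₃ → CoreShellCoercive a h κ₃ := by
  rintro ⟨C, Y, M, N, hY, hdec, hu⟩
  refine ⟨C, Y, M, N, hY, hdec, fun u hfin p => ?_⟩
  obtain ⟨W, hW, hle⟩ := hu u hfin p
  refine ⟨W, hW, le_trans ?_ hle⟩
  have hnn : 0 ≤ ∑' q : ℤ × ℤ × ℤ,
      (if 0 < ‖hcpSite a h q - hcpSite a h p‖ ∧ ‖hcpSite a h q - hcpSite a h p‖ ≤ 11 / 10 * a then
        (inner ℝ (hcpSite a h q - hcpSite a h p) (u q - u p)) ^ 2 else (0 : ℝ)) :=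
    tsum_nonneg fun q => by split_ifs <;> positivity
  nlinarith [mul_nonneg h₁ hnn]

/-- The combined form with `κ₁ > 0`, `κ₃ ≥ 0` implies r3's `CoreSitewiseHarmonic` (radial coercivity with SOME `κ > 0`):
r3's registered stub `stub_coreSitewiseHarmonic` becomes a corollary of `stub_coreStarCoercive`. -/
theorem coreSitewiseHarmonic_of_star {a h κ₁ κ₃ : ℝ} (h₁ : 0 < κ₁) (h₃ : 0 ≤ κ₃) :
    CoreStarCoercive a h κ₁ κ₃ → CoreSitewiseHarmonic a h := by
  rintro ⟨C, Y, M, N, hY, hdec, hu⟩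
  refine ⟨κ₁, C, Y, M, N, h₁, hY, hdec, fun u hfin p => ?_⟩
  obtain ⟨W, hW, hle⟩ := hu u hfin p
  refine le_trans ?_ hle
  have hnn : 0 ≤ ∑' q : ℤ × ℤ × ℤ,
      (if 0 < ‖hcpSite a h q - hcpSite a h p‖ ∧ ‖hcpSite a h q - hcpSite a h p‖ ≤ 11 / 10 * a then
        ‖u q - u p - W (hcpSite a h q - hcpSite a h p)‖ ^ 2 else (0 : ℝ)) :=
    tsum_nonneg fun q => by split_ifs <;> positivity
  nlinarith [mul_nonneg h₃ hnn]

/-- H2⋆ is antitone in both constants. -/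
theorem coreStarCoercive_mono {a h κ₁ κ₃ κ₁' κ₃' : ℝ} (h₁ : κ₁' ≤ κ₁) (h₃ : κ₃' ≤ κ₃) :
    CoreStarCoercive a h κ₁ κ₃ → CoreStarCoercive a h κ₁' κ₃' := by
  rintro ⟨C, Y, M, N, hY, hdec, hu⟩
  refine ⟨C, Y, M, N, hY, hdec, fun u hfin p => ?_⟩
  obtain ⟨W, hW, hle⟩ := hu u hfin p
  refine ⟨W, hW, le_trans ?_ hle⟩
  have hA : 0 ≤ ∑' q : ℤ × ℤ × ℤ,
      (if 0 < ‖hcpSite a h q - hcpSite a h p‖ ∧ ‖hcpSite a h q - hcpSite a h p‖ ≤ 11 / 10 * a then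
        (inner ℝ (hcpSite a h q - hcpSite a h p) (u q - u p)) ^ 2 else (0 : ℝ)) :=
    tsum_nonneg fun q => by split_ifs <;> positivity
  have hB : 0 ≤ ∑' q : ℤ × ℤ × ℤ,
      (if 0 < ‖hcpSite a h q - hcpSite a h p‖ ∧ ‖hcpSite a h q - hcpSite a h p‖ ≤ 11 / 10 * a then
        ‖u q - u p - W (hcpSite a h q - hcpSite a h p)‖ ^ 2 else (0 : ℝ)) :=
    tsum_nonneg fun q => by split_ifs <;> positivity
  nlinarith [mul_le_mul_of_nonneg_right h₁ hA, mul_le_mul_of_nonneg_right h₃ hB]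

/-- **H3⋆ — the quantitative assembly from the combined coercivity** (the registered form of H3 after reshape r4):
H1 ∧ H2⋆(κ₁, κ₃) at the family minimiser ⇒ the core for tolerances `η₀ ≤ a/N₀` (the stretch part of the cubic remainder
is charged to `κ₁`, strictness and the transverse part to `κ₃`).  Line-internal proof obligation (stub
`stub_coreStarAssembly`). [folklore] -/
def CoreStarAssembly (κ₁ κ₃ N₀ a h : ℝ) : Prop :=
  0 < a → 0 < h → HcpFamilyMin a h → CoreFirstOrderDesign a h → CoreStarCoercive a h κ₁ κ₃ →
    ∀ δ : ℝ, 0 < δ → ∀ t η₀ : ℝ, |t| ≤ 1 / 100 → h = (1 + t) * a * Real.sqrt (2 / 3) →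
      ∀ (ha : a ≠ 0) (hh : h ≠ 0), 0 < η₀ → η₀ ≤ a / N₀ →
        PerturbativeCore δ a t η₀ ((hcpPeriodicConfiguration ha hh).energyPerParticle lennardJones)

/-- An assembly from the rotation-only coercivity `κ₃` is an assembly from the combined one (`κ₁ ≥ 0`). -/
theorem coreStarAssembly_of_shell {κ₁ κ₃ N₀ a h : ℝ} (h₁ : 0 ≤ κ₁) :
    CoreShellAssembly κ₃ N₀ a h → CoreStarAssembly κ₁ κ₃ N₀ a h :=
  fun hS ha hh hfam hd hc => hS ha hh hfam hd (coreShellCoercive_of_star h₁ hc)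

/-- **Registered anchor `stub_perturbativeCoreOfStarPieces` (reshape r4, combined): the core from H1, H2⋆(κ₁,κ₃) and
H3⋆(κ₁,κ₃,N₀), at tolerance fraction `1/N₀`.** -/
theorem stub_perturbativeCoreOfStarPieces : ∀ κ₁ κ₃ N₀ : ℝ,
    (∀ a h : ℝ, 0 < a → 0 < h → HcpFamilyMin a h → CoreFirstOrderDesign a h) →
    (∀ a h : ℝ, 0 < a → 0 < h → HcpFamilyMin a h → CoreStarCoercive a h κ₁ κ₃) →
    (∀ a h : ℝ, CoreStarAssembly κ₁ κ₃ N₀ a h) →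
    ∀ δ : ℝ, 0 < δ → ∀ a h t η₀ : ℝ, 0 < a → |t| ≤ 1 / 100 →
      h = (1 + t) * a * Real.sqrt (2 / 3) → HcpFamilyMin a h → ∀ (ha : a ≠ 0) (hh : h ≠ 0),
        0 < η₀ → η₀ ≤ a / N₀ →
          PerturbativeCore δ a t η₀ ((hcpPeriodicConfiguration ha hh).energyPerParticle lennardJones) := by
  intro κ₁ κ₃ N₀ h1 h2 h3 δ hδ a h t η₀ ha ht hht hfam ha' hh' hη₀ hη
  have hpos : 0 < h := by
    have h1t : 0 < 1 + t := by have := (abs_le.1 ht).1; linarith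
    rw [hht]
    exact mul_pos (mul_pos h1t ha) (Real.sqrt_pos.2 (by norm_num))
  exact h3 a h ha hpos hfam (h1 a h ha hpos hfam) (h2 a h ha hpos hfam) δ hδ t η₀ ht hht ha' hh' hη₀ hη

end Summit.AtomisticToContinuum.Crystallization.Theorems.StrictSplittingRuleBirth

end
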